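import Summits.HodgeConjecture.FermatCycles.ConditionQFourfoldSearch
import Summits.HodgeConjecture.FermatCycles.ConditionQFourfoldSixtySixTable
import HarnessLib

/-!
# Shioda's stable-generation condition `(Q⁴ₘ)` at `m = 66` — kernel certificate (part B of 3)

HONEST FRAMING: explicit algebraic cycles for specific Hodge classes on Fermat/Delsarte varieties;
residual open instances listed; no claim on general Hodge.

Topic path `Summits/HodgeConjecture/FermatCycles/` of cell `pub-hfermat` (new work, not literature: a computer determination of the cell —
`pub-hfermat-enum/P4-TABLE.md` §(Q⁴ₘ), two implementations — certified by the Lean kernel). Framework: `ConditionQFourfold.lean`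
(certificate Booleans, searches `checkQU`/`checkQN`) and `ConditionQFourfoldSearch.lean` (`conditionQ_four_of_normalized`).

THE STATEMENT. Shioda, Math. Ann. 245 (1979) §4 p. 183: `(Qⁿₘ)` — every element of `Mₘ(y)`, `3 ≤ y ≤ n/2 + 1`, is `ξ₁ − ξ₂` with
`ξ₁, ξ₂ ∈ M'ₘ = ⟨Mₘ(1), Mₘ(2), Mₘ(3)^sd⟩` (pairs, Hodge classes of the Fermat surface, semi-decomposable sextuples); by his Claim
(p. 183, Lemmas 2–3) `(Qⁿₘ)` may replace `(Pⁿₘ)` in Theorem III (`⇒` the Hodge conjecture for `Xⁿₘ`); p. 184: "we do not know any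
value of `m` which satisfies `(Qₘ)` but not `(Pₘ)`". Tree: `Literature.AlgebraicGeometry.Shioda1979.ConditionQ m n`, `MPrime`,
`forall_of_conditionQ` (the Claim's arithmetic spine), `ConditionP` (Math. Ann. form of `(P)`), `FermatCharacter.ShiodaConditionUpTo`
(Proc. Japan Acad. form, with the semi-decomposable alternative).

WHAT IS PROVED HERE (level `m = 66`, part B).
* part B of 3: the kernel searches `checkQN 66 T 4 4`, `checkQN 66 T 8 3` (109508 tuples);

NUMBERS (this seat's search `code/lit/q4/q4norm.py` = implementation 2; implementation 1 = ENUM `code/enum/q4table.py`,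
`data/shioda_Q4_m3-100.json`): case U visits 78778 sorted tuples and case N 178841; 4636 of them are Hodge sextuples; all but 71 carry a
`(P)`-witness (case N pair 97, case N quasi 62, case N pair 3266, case N quasi 150, case N semi 32, case U pair 865, case U quasi 86, case U semi 7); the other 71 — `(1, 5, 36, 38, 54, 64)` (case U); `(1, 5, 45, 46, 50, 51)` (case U); `(1, 6, 10, 54, 63, 64)` (case U); `(1, 8, 22, 50, 55, 62)` (case U); `(1, 8, 23, 52, 54, 60)` (case U); `(1, 9, 10, 53, 62, 63)` (case U); `(1, 9, 23, 51, 54, 60)` (case U); `(1, 9, 34, 46, 48, 60)` (case U); `(1, 10, 18, 51, 54, 64)` (case U); `(1, 10, 24, 46, 54, 63)` (case U); `(1, 10, 27, 36, 60, 64)` (case U); `(1, 10, 36, 42, 45, 64)` (case U); `(1, 10, 36, 45, 46, 60)` (case U); `(1, 12, 34, 45, 46, 60)` (case U); `(1, 18, 23, 37, 59, 60)` (case U); `(1, 20, 23, 36, 54, 64)` (case U); `(1, 22, 25, 31, 55, 64)` (case U); `(1, 22, 25, 37, 55, 58)` (case U); `(1, 22, 34, 37, 49, 55)` (case U); `(1,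 23, 24, 34, 56, 60)` (case U); `(1, 23, 24, 36, 54, 60)` (case U); `(1, 23, 25, 47, 48, 54)` (case U); `(1, 24, 26, 34, 53, 60)` (case U); `(1, 24, 30, 34, 46, 63)` (case U); `(1, 24, 34, 39, 46, 54)` (case U); `(1, 25, 31, 37, 49, 55)` (case U); `(2, 3, 12, 56, 60, 65)` (case N); `(2, 6, 30, 39, 56, 65)` (case N); `(2, 8, 32, 44, 50, 62)` (case N); `(2, 9, 30, 46, 48, 63)` (case N); `(2, 12, 15, 48, 56, 65)` (case N); `(2, 21, 24, 30, 56, 65)` (case N); `(3, 8, 21, 52, 54, 60)` (case N); `(3, 12, 20, 42, 56, 65)` (case N); `(3, 12, 28, 34, 60, 61)` (case N); `(3, 18, 20, 36, 57, 64)` (case N); `(3, 20, 32, 36, 42, 65)` (case N); `(3, 28, 34, 36, 48, 49)` (case N); `(4, 11, 16, 44, 58, 65)` (case N); `(4, 16, 22, 34, 58, 64)` (case N); `(4, 26, 27, 30, 51, 60)` (case N); `(6, 12, 14, 45, 58, 63)` (case N); `(6, 15, 36, 39, 40, 62)` (case N); `(6, 18, 20, 32, 57, 65)` (case N); `(6,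 20, 21, 30, 56, 65)` (case N); `(6, 20, 21, 32, 54, 65)` (case N); `(6, 28, 30, 34, 39, 61)` (case N); `(8, 15, 26, 42, 48, 59)` (case N); `(8, 18, 26, 30, 57, 59)` (case N); `(8, 21, 26, 30, 54, 59)` (case N); `(9, 10, 16, 42, 60, 61)` (case N); `(9, 16, 38, 39, 42, 54)` (case N); `(10, 11, 28, 44, 46, 59)` (case N); `(10, 11, 28, 44, 52, 53)` (case N); `(10, 11, 40, 44, 46, 47)` (case N); `(10, 15, 16, 36, 60, 61)` (case N); `(10, 16, 18, 39, 54, 61)` (case N); `(10, 16, 36, 42, 45, 49)` (case N); `(10, 18, 32, 42, 45, 51)` (case N); `(10, 22, 28, 40, 46, 52)` (case N); `(10, 27, 28, 36, 48, 49)` (case N); `(12, 15, 16, 34, 60, 61)` (case N); `(12, 15, 28, 34, 48, 61)` (case N); `(12, 20, 27, 32, 42, 65)` (case N); `(12, 24, 27, 28, 50, 57)` (case N); `(12, 27, 28, 34, 48, 49)` (case N); `(14, 20, 22, 26, 55, 61)` (case N); `(14, 20, 26, 38, 44, 56)` (case N); `(15, 21, 24, 34, 48, 56)` (case N); `(16,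 18, 30, 34, 39, 61)` (case N); `(21, 24, 28, 30, 34, 61)` (case N) — carry the table
certificate(s) written out in the statements below (generators checked by `genB`, the identity `s + ΣX = ΣY` by `decide`, all inside the kernel search).

PRINT STATUS (lit seat, 2026-08-20). `66 = 2·3·11`: NO refereed theorem gives the Hodge conjecture for `X⁴₆₆` (not prime / `≤ 21` / prime power / `2pᵉ` / `{2,3,5,7}`-smooth; `3 | 66` puts it outside da Silva's Prop. 3.1; even, outside the odd-degree preprint arXiv:2608.18134). In the tree the sibling cell pub-hodgefermat reaches `66` by LEVEL RAISING from `33`; the cell's table settles `(66, 4)` by Lemma 3 cancellation (E3, two implementations). This file gives an INDEPENDENT route inside Shioda's own 1979 framework: `(Q⁴₆₆)` as a kernel theorem, so HC(X⁴₆₆) follows from the printed Claim alone.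

References: [Shioda1979HodgeFermat] T. Shioda, Math. Ann. 245 (1979) 175–184, §3 p. 180 (`(Pⁿₘ)`), §4 pp. 183–184 (`M'ₘ`, `(Qⁿₘ)`, Claim,
the question); [Shioda1979PJA] T. Shioda, Proc. Japan Acad. 55A (1979) §1 (Definition (i)–(iii), `(Pⁿₘ)'`); [daSilva2021HodgeFermat]
G. da Silva Jr., Experimental Results 2 (2021) e22, Def. 2.4, Question 1; [Aoki2000FermatTypeRemarks] N. Aoki, Comment. Math. Univ.
St. Pauli 49 (2000), Thm 0.1. Cell: `pub-hfermat-enum/P4-TABLE.md`, `data/shioda_Q4_m3-100.json`, `code/lit/q4/` (this seat).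
-/

namespace Summit.HodgeConjecture.FermatCycles.ConditionQFourfold

open Multiset
open Literature.AlgebraicGeometry.HodgeTheory Literature.AlgebraicGeometry.HodgeTheory.FermatCharacter
open Literature.AlgebraicGeometry.Shioda1982 Literature.AlgebraicGeometry.Shioda1979
open Summit.HodgeConjecture.FermatCycles.ShiodaConditionFourfold

/-! ### Level `66` — part B -/

/-! The certificate table at level `66` is the definition `table66` of `ConditionQFourfoldSixtySixTable.lean` (71 entries `(key, X, Y)`,
`s + ΣX = ΣY`; found by `code/lit/q4/q4norm.py`, every entry checked by the kernel inside the searches). -/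

set_option maxHeartbeats 0 in
/-- The `(Q)`-search at level `66`, case N, first free representative in `[4, 8)` (47901 tuples). Kernel.
[cite: Shioda1979HodgeFermat, §4 condition (Qⁿₘ), p. 183] -/
theorem checkQN_66_4 :
    checkQN 66
      table66
      4 4 = true := by
  decide +kernel

set_option maxHeartbeats 0 in
/-- The `(Q)`-search at level `66`, case N, first free representative in `[8, 11)` (61607 tuples). Kernel.
[cite: Shioda1979HodgeFermat, §4 condition (Qⁿₘ), p. 183] -/
theorem checkQN_66_8 :
    checkQN 66
      table66
      8 3 = true := by
  decide +kernel

end Summit.HodgeConjecture.FermatCycles.ConditionQFourfold
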